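import Mathlib
import Summits.Ventures.PercRepro2.CoinChainXASigns
import Summits.Ventures.PercRepro2.CoinKSureAD

/-!
# (XA′) for the GENERAL AND-switch chain from any of the three CRUDE moment bounds
(blind cell PercRepro2, night-2 g26; proofs/NIGHT2-DARC.md §67.9)

With the moments `a = R⁰`, `g = G¹` and the entry-free ideal masses `m = Σ_{I₀} ν c`,
`mˣ, mʸ`, three lower bounds for the gate functional `U001 = Σ G¹ (a0x − a1)(a0y − a2)` hold
UNCONDITIONALLY (no sign condition):
* the τ-layer cake (`tau_layer_bound`): `(a2 m − a0 mʸ)·(a1 g0 − a0 g1) ≤ m·U001`;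
* its mirror, the σ-layer cake: `(a1 m − a0 mˣ)·(a2 g0 − a0 g2) ≤ m·U001`;
* FKG for the world-1 gate: `(a1 g0 − a0 g1)·(a2 g0 − a0 g2) ≤ g0·U001`.
Hence (XA′) `Cross ≤ a0·U001` follows whenever the cross term is below `a0` times any of the three
(`chain_XA'_of_tau_crude`, `chain_XA'_of_sigma_crude`, `chain_XA'_of_fkg_crude`,
`chain_XA'_of_crude`), and so does the general chain at every `ρ`
(`chain_functional_nonneg_of_crude`).  The three sign regimes of `chain_XA'_of_signs`,
`chain_XA'_of_signs_y`, `chain_XA'_of_negative_signs` are the cases where a sign pattern forces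
one of these hypotheses; on the census the union of the three crude conditions with g25's
`Cross ≤ 0` covers ≈ 96–98 % of the instance × marker pairs (cover.py).
-/

namespace Summit.Ventures.PercRepro2.Coin

open Classical

section XACrudeAlg

variable {R : Type*} [Field R] [LinearOrder R] [IsStrictOrderedRing R]

/-- From a lower bound `X ≤ m·U` of the gate functional and `m·Cross ≤ a0·X` with `m > 0`,
`a0 ≥ 0`: `Cross ≤ a0·U`. -/
theorem xa_crude_alg (m Cr a0 X Uv : R) (hm : 0 < m) (ha0 : 0 ≤ a0) (hTL : X ≤ m * Uv)
    (hτ : m * Cr ≤ a0 * X) : Cr ≤ a0 * Uv := by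
  have h1 : a0 * X ≤ a0 * (m * Uv) := mul_le_mul_of_nonneg_left hTL ha0
  nlinarith

end XACrudeAlg

section XACrude

variable {V : Type*} [DecidableEq V] {R : Type*} [Field R] [LinearOrder R] [IsStrictOrderedRing R]

/-- **(XA′) FROM THE CRUDE τ-LAYER-CAKE BOUND**: `Cross ≤ a0·U001` whenever
`m·Cross ≤ a0·(a2 m − a0 mʸ)·(a1 g0 − a0 g1)`. -/
theorem chain_XA'_of_tau_crude (U ent ent' : Finset V) (ν c d d' : Finset V → R)
    (hν0 : ∀ W, 0 ≤ ν W)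
    (hν : ∀ s ⊆ U, ∀ t ⊆ U, ν s * ν t ≤ ν (s ∩ t) * ν (s ∪ t))
    (hc0 : ∀ W, 0 ≤ c W) (hd0 : ∀ W, 0 ≤ d W) (hd'0 : ∀ W, 0 ≤ d' W)
    (hdc : ∀ W, d W ≤ c W) (hd'c : ∀ W, d' W ≤ c W)
    (hcc : ∀ s t, c s * c t ≤ c (s ∩ t) * c (s ∪ t))
    (hd'd' : ∀ s t, d' s * d' t ≤ d' (s ∩ t) * d' (s ∪ t))
    (hcd' : ∀ s t, c s * d' t ≤ c (s ∩ t) * d' (s ∪ t))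
    (hdd' : ∀ s t, d s * d' t ≤ d (s ∩ t) * d' (s ∪ t))
    (hratio' : ∀ s t, s ⊆ t → d' s * c t ≤ c s * d' t)
    (x y : Finset V → R) (hx0 : ∀ W, 0 ≤ x W) (hy0 : ∀ W, 0 ≤ y W)
    (hxm : ∀ s t, x s ≤ x (s ∪ t)) (hym : ∀ s t, y s ≤ y (s ∪ t))
    (hmI : 0 < ∑ W ∈ U.powerset.filter (fun W => ¬ ∃ r ∈ ent ∪ ent', r ∈ W), ν W * c W)
    (hτ : (∑ W ∈ U.powerset.filter (fun W => ¬ ∃ r ∈ ent ∪ ent', r ∈ W), ν W * c W) *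
      ((((∑ W ∈ U.powerset, ν W * chainMix ent ent' 0 c d W) * (∑ W ∈ U.powerset, ν W * chainMix ent ent' 1 c d W * x W) - (∑ W ∈ U.powerset, ν W * chainMix ent ent' 0 c d W * x W) * (∑ W ∈ U.powerset, ν W * chainMix ent ent' 1 c d W)) *
          ((∑ W ∈ U.powerset, ν W * chainMix ent ent' 0 c d W) * (∑ W ∈ U.powerset, ν W * chainMix ent ent' 0 c d' W * y W) - (∑ W ∈ U.powerset, ν W * chainMix ent ent' 0 c d W * y W) * (∑ W ∈ U.powerset, ν W * chainMix ent ent' 0 c d' W))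
        + ((∑ W ∈ U.powerset, ν W * chainMix ent ent' 0 c d W) * (∑ W ∈ U.powerset, ν W * chainMix ent ent' 1 c d W * y W) - (∑ W ∈ U.powerset, ν W * chainMix ent ent' 0 c d W * y W) * (∑ W ∈ U.powerset, ν W * chainMix ent ent' 1 c d W)) *
          ((∑ W ∈ U.powerset, ν W * chainMix ent ent' 0 c d W) * (∑ W ∈ U.powerset, ν W * chainMix ent ent' 0 c d' W * x W) - (∑ W ∈ U.powerset, ν W * chainMix ent ent' 0 c d W * x W) * (∑ W ∈ U.powerset, ν W * chainMix ent ent' 0 c d' W)))) ≤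
      (∑ W ∈ U.powerset, ν W * chainMix ent ent' 0 c d W) * (((∑ W ∈ U.powerset, ν W * chainMix ent ent' 0 c d W * y W) * (∑ W ∈ U.powerset.filter (fun W => ¬ ∃ r ∈ ent ∪ ent', r ∈ W), ν W * c W) - (∑ W ∈ U.powerset, ν W * chainMix ent ent' 0 c d W) * (∑ W ∈ U.powerset.filter (fun W => ¬ ∃ r ∈ ent ∪ ent', r ∈ W), ν W * c W * y W)) * ((∑ W ∈ U.powerset, ν W * chainMix ent ent' 0 c d W * x W) * (∑ W ∈ U.powerset, ν W * chainMix ent ent' 1 c d' W) - (∑ W ∈ U.powerset, ν W * chainMix ent ent' 0 c d W) * (∑ W ∈ U.powerset, ν W * chainMix ent ent' 1 c d' W * x W))))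
    :
    (((∑ W ∈ U.powerset, ν W * chainMix ent ent' 0 c d W) * (∑ W ∈ U.powerset, ν W * chainMix ent ent' 1 c d W * x W) - (∑ W ∈ U.powerset, ν W * chainMix ent ent' 0 c d W * x W) * (∑ W ∈ U.powerset, ν W * chainMix ent ent' 1 c d W)) *
          ((∑ W ∈ U.powerset, ν W * chainMix ent ent' 0 c d W) * (∑ W ∈ U.powerset, ν W * chainMix ent ent' 0 c d' W * y W) - (∑ W ∈ U.powerset, ν W * chainMix ent ent' 0 c d W * y W) * (∑ W ∈ U.powerset, ν W * chainMix ent ent' 0 c d' W))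
        + ((∑ W ∈ U.powerset, ν W * chainMix ent ent' 0 c d W) * (∑ W ∈ U.powerset, ν W * chainMix ent ent' 1 c d W * y W) - (∑ W ∈ U.powerset, ν W * chainMix ent ent' 0 c d W * y W) * (∑ W ∈ U.powerset, ν W * chainMix ent ent' 1 c d W)) *
          ((∑ W ∈ U.powerset, ν W * chainMix ent ent' 0 c d W) * (∑ W ∈ U.powerset, ν W * chainMix ent ent' 0 c d' W * x W) - (∑ W ∈ U.powerset, ν W * chainMix ent ent' 0 c d W * x W) * (∑ W ∈ U.powerset, ν W * chainMix ent ent' 0 c d' W))) ≤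
        (∑ W ∈ U.powerset, ν W * chainMix ent ent' 0 c d W) * ((∑ W ∈ U.powerset, ν W * chainMix ent ent' 0 c d W) * (∑ W ∈ U.powerset, ν W * chainMix ent ent' 0 c d W) * (∑ W ∈ U.powerset, ν W * chainMix ent ent' 1 c d' W * (x W * y W))
          - (∑ W ∈ U.powerset, ν W * chainMix ent ent' 0 c d W) * (∑ W ∈ U.powerset, ν W * chainMix ent ent' 0 c d W * y W) * (∑ W ∈ U.powerset, ν W * chainMix ent ent' 1 c d' W * x W)
          - (∑ W ∈ U.powerset, ν W * chainMix ent ent' 0 c d W) * (∑ W ∈ U.powerset, ν W * chainMix ent ent' 0 c d W * x W) * (∑ W ∈ U.powerset, ν W * chainMix ent ent' 1 c d' W * y W)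
          + (∑ W ∈ U.powerset, ν W * chainMix ent ent' 0 c d W * x W) * (∑ W ∈ U.powerset, ν W * chainMix ent ent' 0 c d W * y W) * (∑ W ∈ U.powerset, ν W * chainMix ent ent' 1 c d' W)) := by
  have hm0 : ∀ W, 0 ≤ chainMix ent ent' 0 c d W := chainMix_nonneg ent ent' le_rfl zero_le_one hc0 hd0
  have hm1' : ∀ W, 0 ≤ chainMix ent ent' 1 c d' W :=
    chainMix_nonneg ent ent' zero_le_one le_rfl hc0 hd'0
  have hR0_0 : ∀ W, 0 ≤ ν W * chainMix ent ent' 0 c d W := fun W => mul_nonneg (hν0 W) (hm0 W)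
  have hG1_0 : ∀ W, 0 ≤ ν W * chainMix ent ent' 1 c d' W := fun W => mul_nonneg (hν0 W) (hm1' W)
  -- the gate `G¹` is log-supermodular and Holley-above `R⁰` from every cluster meeting `ent ∪ ent'`
  have hmix' := mixture_lsm ent ent' 1 zero_le_one le_rfl c d' hc0 hd'0 hd'c hcc hd'd' hcd' hratio'
  have wMM : ∀ s ⊆ U, ∀ t ⊆ U, ν s * chainMix ent ent' 1 c d' s * (ν t * chainMix ent ent' 1 c d' t) ≤
      ν (s ∩ t) * chainMix ent ent' 1 c d' (s ∩ t) * (ν (s ∪ t) * chainMix ent ent' 1 c d' (s ∪ t)) := by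
    intro s hs t ht
    calc ν s * chainMix ent ent' 1 c d' s * (ν t * chainMix ent ent' 1 c d' t)
        = (ν s * ν t) * (chainMix ent ent' 1 c d' s * chainMix ent ent' 1 c d' t) := by ring
      _ ≤ (ν (s ∩ t) * ν (s ∪ t)) *
            (chainMix ent ent' 1 c d' (s ∩ t) * chainMix ent ent' 1 c d' (s ∪ t)) :=
          mul_le_mul (hν s hs t ht) (hmix' s t) (mul_nonneg (hm1' _) (hm1' _))
            (mul_nonneg (hν0 _) (hν0 _))
      _ = _ := by ring
  have wML : ∀ s ⊆ U, ∀ t ⊆ U, (∃ r ∈ ent ∪ ent', r ∈ s) →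
      ν s * chainMix ent ent' 1 c d' s * (ν t * chainMix ent ent' 0 c d t) ≤
        ν (s ∩ t) * chainMix ent ent' 0 c d (s ∩ t) * (ν (s ∪ t) * chainMix ent ent' 1 c d' (s ∪ t)) := by
    intro s hs t ht hse
    have hsu : ∃ r ∈ ent ∪ ent', r ∈ s ∪ t := by
      obtain ⟨r, hr, hrs⟩ := hse; exact ⟨r, hr, Finset.mem_union_left _ hrs⟩
    rw [chainMix_one_of_meet ent ent' c d' hse, chainMix_one_of_meet ent ent' c d' hsu]
    calc ν s * d' s * (ν t * chainMix ent ent' 0 c d t)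
        = (ν s * ν t) * (d' s * chainMix ent ent' 0 c d t) := by ring
      _ ≤ (ν (s ∩ t) * ν (s ∪ t)) * (chainMix ent ent' 0 c d (s ∩ t) * d' (s ∪ t)) :=
          mul_le_mul (hν s hs t ht)
            (chain_cross_holley ent ent' 0 le_rfl zero_le_one c d d' hdc hcd' hdd' hd'0 s t)
            (mul_nonneg (hd'0 _) (hm0 _)) (mul_nonneg (hν0 _) (hν0 _))
      _ = _ := by ring
  -- the τ-layer-cake bound for the cross pair `(R⁰, G¹)` with entries `ent ∪ ent'`
  have hTL := tau_layer_bound U (ent ∪ ent') (fun W => ν W * chainMix ent ent' 0 c d W)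
    (fun W => ν W * chainMix ent ent' 1 c d' W) x y hR0_0 hG1_0 hx0 hy0 hxm hym wMM wML
  beta_reduce at hTL
  -- the ideal filters agree with the form of `hmI`
  have hfilt : U.powerset.filter (fun W => W ∩ (ent ∪ ent') = ∅) =
      U.powerset.filter (fun W => ¬ ∃ r ∈ ent ∪ ent', r ∈ W) :=
    Finset.filter_congr fun W _ => inter_eq_empty_iff_not_meets (ent ∪ ent') W
  have hN : (∑ W ∈ U.powerset.filter (fun W => W ∩ (ent ∪ ent') = ∅),
      ν W * chainMix ent ent' 1 c d' W) =
      ∑ W ∈ U.powerset.filter (fun W => ¬ ∃ r ∈ ent ∪ ent', r ∈ W), ν W * c W := by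
    rw [hfilt]
    exact Finset.sum_congr rfl fun W hW => by
      rw [chainMix_of_not_meet ent ent' 1 c d' (Finset.mem_filter.1 hW).2]
  have hNy : (∑ W ∈ U.powerset.filter (fun W => W ∩ (ent ∪ ent') = ∅),
      ν W * chainMix ent ent' 1 c d' W * y W) =
      ∑ W ∈ U.powerset.filter (fun W => ¬ ∃ r ∈ ent ∪ ent', r ∈ W), ν W * c W * y W := by
    rw [hfilt]
    exact Finset.sum_congr rfl fun W hW => by
      rw [chainMix_of_not_meet ent ent' 1 c d' (Finset.mem_filter.1 hW).2]
  rw [hN, hNy] at hTL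
  -- the gate functional is `U001`
  have hSG := centred_expand_sc (fun W => ν W * chainMix ent ent' 1 c d' W) x y U.powerset
    (∑ W ∈ U.powerset, ν W * chainMix ent ent' 0 c d W)
    (∑ W ∈ U.powerset, ν W * chainMix ent ent' 0 c d W * x W)
    (∑ W ∈ U.powerset, ν W * chainMix ent ent' 0 c d W * y W)
  beta_reduce at hSG
  rw [hSG] at hTL
  -- the killed `x`-shift `K = a1 g0 − a0 g1`
  have hK : (∑ W ∈ U.powerset, (ν W * chainMix ent ent' 0 c d W - ν W * chainMix ent ent' 1 c d' W) *
      ((∑ W ∈ U.powerset, ν W * chainMix ent ent' 0 c d W) * x W -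
        (∑ W ∈ U.powerset, ν W * chainMix ent ent' 0 c d W * x W))) =
      (∑ W ∈ U.powerset, ν W * chainMix ent ent' 0 c d W * x W) *
          (∑ W ∈ U.powerset, ν W * chainMix ent ent' 1 c d' W) -
        (∑ W ∈ U.powerset, ν W * chainMix ent ent' 0 c d W) *
          (∑ W ∈ U.powerset, ν W * chainMix ent ent' 1 c d' W * x W) := by
    rw [Finset.sum_congr rfl (fun W _ => show
      (ν W * chainMix ent ent' 0 c d W - ν W * chainMix ent ent' 1 c d' W) *
        ((∑ W ∈ U.powerset, ν W * chainMix ent ent' 0 c d W) * x W -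
          (∑ W ∈ U.powerset, ν W * chainMix ent ent' 0 c d W * x W)) =
      ((∑ W ∈ U.powerset, ν W * chainMix ent ent' 0 c d W) * (ν W * chainMix ent ent' 0 c d W * x W)
        - (∑ W ∈ U.powerset, ν W * chainMix ent ent' 0 c d W * x W) * (ν W * chainMix ent ent' 0 c d W))
      - ((∑ W ∈ U.powerset, ν W * chainMix ent ent' 0 c d W) * (ν W * chainMix ent ent' 1 c d' W * x W)
        - (∑ W ∈ U.powerset, ν W * chainMix ent ent' 0 c d W * x W) * (ν W * chainMix ent ent' 1 c d' W))
      from by ring)]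
    rw [Finset.sum_sub_distrib, Finset.sum_sub_distrib, Finset.sum_sub_distrib,
      ← Finset.mul_sum, ← Finset.mul_sum, ← Finset.mul_sum, ← Finset.mul_sum]
    ring
  rw [hK] at hTL
  have ha0 : 0 ≤ ∑ W ∈ U.powerset, ν W * chainMix ent ent' 0 c d W :=
    Finset.sum_nonneg fun W _ => hR0_0 W
  exact xa_crude_alg _ _ _ _ _ hmI ha0 hTL hτ

/-- **(XA′) FROM THE CRUDE σ-LAYER-CAKE BOUND** (the mirror): `Cross ≤ a0·U001` whenever
`m·Cross ≤ a0·(a1 m − a0 mˣ)·(a2 g0 − a0 g2)`. -/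
theorem chain_XA'_of_sigma_crude (U ent ent' : Finset V) (ν c d d' : Finset V → R)
    (hν0 : ∀ W, 0 ≤ ν W)
    (hν : ∀ s ⊆ U, ∀ t ⊆ U, ν s * ν t ≤ ν (s ∩ t) * ν (s ∪ t))
    (hc0 : ∀ W, 0 ≤ c W) (hd0 : ∀ W, 0 ≤ d W) (hd'0 : ∀ W, 0 ≤ d' W)
    (hdc : ∀ W, d W ≤ c W) (hd'c : ∀ W, d' W ≤ c W)
    (hcc : ∀ s t, c s * c t ≤ c (s ∩ t) * c (s ∪ t))
    (hd'd' : ∀ s t, d' s * d' t ≤ d' (s ∩ t) * d' (s ∪ t))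
    (hcd' : ∀ s t, c s * d' t ≤ c (s ∩ t) * d' (s ∪ t))
    (hdd' : ∀ s t, d s * d' t ≤ d (s ∩ t) * d' (s ∪ t))
    (hratio' : ∀ s t, s ⊆ t → d' s * c t ≤ c s * d' t)
    (x y : Finset V → R) (hx0 : ∀ W, 0 ≤ x W) (hy0 : ∀ W, 0 ≤ y W)
    (hxm : ∀ s t, x s ≤ x (s ∪ t)) (hym : ∀ s t, y s ≤ y (s ∪ t))
    (hmI : 0 < ∑ W ∈ U.powerset.filter (fun W => ¬ ∃ r ∈ ent ∪ ent', r ∈ W), ν W * c W)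
    (hσ : (∑ W ∈ U.powerset.filter (fun W => ¬ ∃ r ∈ ent ∪ ent', r ∈ W), ν W * c W) *
      ((((∑ W ∈ U.powerset, ν W * chainMix ent ent' 0 c d W) * (∑ W ∈ U.powerset, ν W * chainMix ent ent' 1 c d W * x W) - (∑ W ∈ U.powerset, ν W * chainMix ent ent' 0 c d W * x W) * (∑ W ∈ U.powerset, ν W * chainMix ent ent' 1 c d W)) *
          ((∑ W ∈ U.powerset, ν W * chainMix ent ent' 0 c d W) * (∑ W ∈ U.powerset, ν W * chainMix ent ent' 0 c d' W * y W) - (∑ W ∈ U.powerset, ν W * chainMix ent ent' 0 c d W * y W) * (∑ W ∈ U.powerset, ν W * chainMix ent ent' 0 c d' W))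
        + ((∑ W ∈ U.powerset, ν W * chainMix ent ent' 0 c d W) * (∑ W ∈ U.powerset, ν W * chainMix ent ent' 1 c d W * y W) - (∑ W ∈ U.powerset, ν W * chainMix ent ent' 0 c d W * y W) * (∑ W ∈ U.powerset, ν W * chainMix ent ent' 1 c d W)) *
          ((∑ W ∈ U.powerset, ν W * chainMix ent ent' 0 c d W) * (∑ W ∈ U.powerset, ν W * chainMix ent ent' 0 c d' W * x W) - (∑ W ∈ U.powerset, ν W * chainMix ent ent' 0 c d W * x W) * (∑ W ∈ U.powerset, ν W * chainMix ent ent' 0 c d' W)))) ≤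
      (∑ W ∈ U.powerset, ν W * chainMix ent ent' 0 c d W) * (((∑ W ∈ U.powerset, ν W * chainMix ent ent' 0 c d W * x W) * (∑ W ∈ U.powerset.filter (fun W => ¬ ∃ r ∈ ent ∪ ent', r ∈ W), ν W * c W) - (∑ W ∈ U.powerset, ν W * chainMix ent ent' 0 c d W) * (∑ W ∈ U.powerset.filter (fun W => ¬ ∃ r ∈ ent ∪ ent', r ∈ W), ν W * c W * x W)) * ((∑ W ∈ U.powerset, ν W * chainMix ent ent' 0 c d W * y W) * (∑ W ∈ U.powerset, ν W * chainMix ent ent' 1 c d' W) - (∑ W ∈ U.powerset, ν W * chainMix ent ent' 0 c d W) * (∑ W ∈ U.powerset, ν W * chainMix ent ent' 1 c d' W * y W))))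
    :
    (((∑ W ∈ U.powerset, ν W * chainMix ent ent' 0 c d W) * (∑ W ∈ U.powerset, ν W * chainMix ent ent' 1 c d W * x W) - (∑ W ∈ U.powerset, ν W * chainMix ent ent' 0 c d W * x W) * (∑ W ∈ U.powerset, ν W * chainMix ent ent' 1 c d W)) *
          ((∑ W ∈ U.powerset, ν W * chainMix ent ent' 0 c d W) * (∑ W ∈ U.powerset, ν W * chainMix ent ent' 0 c d' W * y W) - (∑ W ∈ U.powerset, ν W * chainMix ent ent' 0 c d W * y W) * (∑ W ∈ U.powerset, ν W * chainMix ent ent' 0 c d' W))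
        + ((∑ W ∈ U.powerset, ν W * chainMix ent ent' 0 c d W) * (∑ W ∈ U.powerset, ν W * chainMix ent ent' 1 c d W * y W) - (∑ W ∈ U.powerset, ν W * chainMix ent ent' 0 c d W * y W) * (∑ W ∈ U.powerset, ν W * chainMix ent ent' 1 c d W)) *
          ((∑ W ∈ U.powerset, ν W * chainMix ent ent' 0 c d W) * (∑ W ∈ U.powerset, ν W * chainMix ent ent' 0 c d' W * x W) - (∑ W ∈ U.powerset, ν W * chainMix ent ent' 0 c d W * x W) * (∑ W ∈ U.powerset, ν W * chainMix ent ent' 0 c d' W))) ≤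
        (∑ W ∈ U.powerset, ν W * chainMix ent ent' 0 c d W) * ((∑ W ∈ U.powerset, ν W * chainMix ent ent' 0 c d W) * (∑ W ∈ U.powerset, ν W * chainMix ent ent' 0 c d W) * (∑ W ∈ U.powerset, ν W * chainMix ent ent' 1 c d' W * (x W * y W))
          - (∑ W ∈ U.powerset, ν W * chainMix ent ent' 0 c d W) * (∑ W ∈ U.powerset, ν W * chainMix ent ent' 0 c d W * y W) * (∑ W ∈ U.powerset, ν W * chainMix ent ent' 1 c d' W * x W)
          - (∑ W ∈ U.powerset, ν W * chainMix ent ent' 0 c d W) * (∑ W ∈ U.powerset, ν W * chainMix ent ent' 0 c d W * x W) * (∑ W ∈ U.powerset, ν W * chainMix ent ent' 1 c d' W * y W)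
          + (∑ W ∈ U.powerset, ν W * chainMix ent ent' 0 c d W * x W) * (∑ W ∈ U.powerset, ν W * chainMix ent ent' 0 c d W * y W) * (∑ W ∈ U.powerset, ν W * chainMix ent ent' 1 c d' W)) := by
  have h := chain_XA'_of_tau_crude U ent ent' ν c d d' hν0 hν hc0 hd0 hd'0 hdc hd'c hcc hd'd'
    hcd' hdd' hratio' y x hy0 hx0 hym hxm hmI (by linarith [hσ])
  have e : (∑ W ∈ U.powerset, ν W * chainMix ent ent' 1 c d' W * (y W * x W)) =
      ∑ W ∈ U.powerset, ν W * chainMix ent ent' 1 c d' W * (x W * y W) :=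
    Finset.sum_congr rfl fun W _ => by rw [mul_comm (y W)]
  rw [e] at h
  linarith [h]

/-- **(XA′) FROM THE CRUDE FKG BOUND**: `Cross ≤ a0·U001` whenever
`g0·Cross ≤ a0·(a1 g0 − a0 g1)·(a2 g0 − a0 g2)`. -/
theorem chain_XA'_of_fkg_crude (U ent ent' : Finset V) (ν c d d' : Finset V → R)
    (hν0 : ∀ W, 0 ≤ ν W)
    (hν : ∀ s ⊆ U, ∀ t ⊆ U, ν s * ν t ≤ ν (s ∩ t) * ν (s ∪ t))
    (hc0 : ∀ W, 0 ≤ c W) (hd0 : ∀ W, 0 ≤ d W) (hd'0 : ∀ W, 0 ≤ d' W)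
    (hd'c : ∀ W, d' W ≤ c W)
    (hcc : ∀ s t, c s * c t ≤ c (s ∩ t) * c (s ∪ t))
    (hd'd' : ∀ s t, d' s * d' t ≤ d' (s ∩ t) * d' (s ∪ t))
    (hcd' : ∀ s t, c s * d' t ≤ c (s ∩ t) * d' (s ∪ t))
    (hratio' : ∀ s t, s ⊆ t → d' s * c t ≤ c s * d' t)
    (x y : Finset V → R) (hx0 : ∀ W, 0 ≤ x W) (hy0 : ∀ W, 0 ≤ y W)
    (hxm : ∀ s t, x s ≤ x (s ∪ t)) (hym : ∀ s t, y s ≤ y (s ∪ t))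
    (hmI : 0 < ∑ W ∈ U.powerset.filter (fun W => ¬ ∃ r ∈ ent ∪ ent', r ∈ W), ν W * c W)
    (hF : (∑ W ∈ U.powerset, ν W * chainMix ent ent' 1 c d' W) *
      ((((∑ W ∈ U.powerset, ν W * chainMix ent ent' 0 c d W) * (∑ W ∈ U.powerset, ν W * chainMix ent ent' 1 c d W * x W) - (∑ W ∈ U.powerset, ν W * chainMix ent ent' 0 c d W * x W) * (∑ W ∈ U.powerset, ν W * chainMix ent ent' 1 c d W)) *
          ((∑ W ∈ U.powerset, ν W * chainMix ent ent' 0 c d W) * (∑ W ∈ U.powerset, ν W * chainMix ent ent' 0 c d' W * y W) - (∑ W ∈ U.powerset, ν W * chainMix ent ent' 0 c d W * y W) * (∑ W ∈ U.powerset, ν W * chainMix ent ent' 0 c d' W))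
        + ((∑ W ∈ U.powerset, ν W * chainMix ent ent' 0 c d W) * (∑ W ∈ U.powerset, ν W * chainMix ent ent' 1 c d W * y W) - (∑ W ∈ U.powerset, ν W * chainMix ent ent' 0 c d W * y W) * (∑ W ∈ U.powerset, ν W * chainMix ent ent' 1 c d W)) *
          ((∑ W ∈ U.powerset, ν W * chainMix ent ent' 0 c d W) * (∑ W ∈ U.powerset, ν W * chainMix ent ent' 0 c d' W * x W) - (∑ W ∈ U.powerset, ν W * chainMix ent ent' 0 c d W * x W) * (∑ W ∈ U.powerset, ν W * chainMix ent ent' 0 c d' W)))) ≤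
      (∑ W ∈ U.powerset, ν W * chainMix ent ent' 0 c d W) * (((∑ W ∈ U.powerset, ν W * chainMix ent ent' 0 c d W * x W) * (∑ W ∈ U.powerset, ν W * chainMix ent ent' 1 c d' W) - (∑ W ∈ U.powerset, ν W * chainMix ent ent' 0 c d W) * (∑ W ∈ U.powerset, ν W * chainMix ent ent' 1 c d' W * x W)) * ((∑ W ∈ U.powerset, ν W * chainMix ent ent' 0 c d W * y W) * (∑ W ∈ U.powerset, ν W * chainMix ent ent' 1 c d' W) - (∑ W ∈ U.powerset, ν W * chainMix ent ent' 0 c d W) * (∑ W ∈ U.powerset, ν W * chainMix ent ent' 1 c d' W * y W))))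
    :
    (((∑ W ∈ U.powerset, ν W * chainMix ent ent' 0 c d W) * (∑ W ∈ U.powerset, ν W * chainMix ent ent' 1 c d W * x W) - (∑ W ∈ U.powerset, ν W * chainMix ent ent' 0 c d W * x W) * (∑ W ∈ U.powerset, ν W * chainMix ent ent' 1 c d W)) *
          ((∑ W ∈ U.powerset, ν W * chainMix ent ent' 0 c d W) * (∑ W ∈ U.powerset, ν W * chainMix ent ent' 0 c d' W * y W) - (∑ W ∈ U.powerset, ν W * chainMix ent ent' 0 c d W * y W) * (∑ W ∈ U.powerset, ν W * chainMix ent ent' 0 c d' W))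
        + ((∑ W ∈ U.powerset, ν W * chainMix ent ent' 0 c d W) * (∑ W ∈ U.powerset, ν W * chainMix ent ent' 1 c d W * y W) - (∑ W ∈ U.powerset, ν W * chainMix ent ent' 0 c d W * y W) * (∑ W ∈ U.powerset, ν W * chainMix ent ent' 1 c d W)) *
          ((∑ W ∈ U.powerset, ν W * chainMix ent ent' 0 c d W) * (∑ W ∈ U.powerset, ν W * chainMix ent ent' 0 c d' W * x W) - (∑ W ∈ U.powerset, ν W * chainMix ent ent' 0 c d W * x W) * (∑ W ∈ U.powerset, ν W * chainMix ent ent' 0 c d' W))) ≤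
        (∑ W ∈ U.powerset, ν W * chainMix ent ent' 0 c d W) * ((∑ W ∈ U.powerset, ν W * chainMix ent ent' 0 c d W) * (∑ W ∈ U.powerset, ν W * chainMix ent ent' 0 c d W) * (∑ W ∈ U.powerset, ν W * chainMix ent ent' 1 c d' W * (x W * y W))
          - (∑ W ∈ U.powerset, ν W * chainMix ent ent' 0 c d W) * (∑ W ∈ U.powerset, ν W * chainMix ent ent' 0 c d W * y W) * (∑ W ∈ U.powerset, ν W * chainMix ent ent' 1 c d' W * x W)
          - (∑ W ∈ U.powerset, ν W * chainMix ent ent' 0 c d W) * (∑ W ∈ U.powerset, ν W * chainMix ent ent' 0 c d W * x W) * (∑ W ∈ U.powerset, ν W * chainMix ent ent' 1 c d' W * y W)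
          + (∑ W ∈ U.powerset, ν W * chainMix ent ent' 0 c d W * x W) * (∑ W ∈ U.powerset, ν W * chainMix ent ent' 0 c d W * y W) * (∑ W ∈ U.powerset, ν W * chainMix ent ent' 1 c d' W)) := by
  have hm1' : ∀ W, 0 ≤ chainMix ent ent' 1 c d' W :=
    chainMix_nonneg ent ent' zero_le_one le_rfl hc0 hd'0
  have hm0 : ∀ W, 0 ≤ chainMix ent ent' 0 c d W := chainMix_nonneg ent ent' le_rfl zero_le_one hc0 hd0
  have hR0_0 : ∀ W, 0 ≤ ν W * chainMix ent ent' 0 c d W := fun W => mul_nonneg (hν0 W) (hm0 W)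
  have hG1_0 : ∀ W, 0 ≤ ν W * chainMix ent ent' 1 c d' W := fun W => mul_nonneg (hν0 W) (hm1' W)
  have hmix' := mixture_lsm ent ent' 1 zero_le_one le_rfl c d' hc0 hd'0 hd'c hcc hd'd' hcd' hratio'
  -- FKG for the world-1 gate
  have hfkg0 : (∑ W ∈ U.powerset, ν W * chainMix ent ent' 1 c d' W * x W) *
      (∑ W ∈ U.powerset, ν W * chainMix ent ent' 1 c d' W * y W) ≤
      (∑ W ∈ U.powerset, ν W * chainMix ent ent' 1 c d' W) *
      (∑ W ∈ U.powerset, ν W * chainMix ent ent' 1 c d' W * (x W * y W)) := by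
    refine ad_pointwise U _ _ _ _ (fun W => mul_nonneg (hG1_0 W) (hx0 W))
      (fun W => mul_nonneg (hG1_0 W) (hy0 W)) hG1_0
      (fun W => mul_nonneg (hG1_0 W) (mul_nonneg (hx0 W) (hy0 W))) ?_
    intro s hs t ht
    have hxs : x s ≤ x (s ∪ t) := hxm s t
    have hyt : y t ≤ y (s ∪ t) := by rw [Finset.union_comm]; exact hym t s
    have hlsm : ν s * chainMix ent ent' 1 c d' s * (ν t * chainMix ent ent' 1 c d' t) ≤
        ν (s ∩ t) * chainMix ent ent' 1 c d' (s ∩ t) * (ν (s ∪ t) * chainMix ent ent' 1 c d' (s ∪ t)) := by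
      calc ν s * chainMix ent ent' 1 c d' s * (ν t * chainMix ent ent' 1 c d' t)
          = (ν s * ν t) * (chainMix ent ent' 1 c d' s * chainMix ent ent' 1 c d' t) := by ring
        _ ≤ (ν (s ∩ t) * ν (s ∪ t)) *
              (chainMix ent ent' 1 c d' (s ∩ t) * chainMix ent ent' 1 c d' (s ∪ t)) :=
            mul_le_mul (hν s hs t ht) (hmix' s t) (mul_nonneg (hm1' _) (hm1' _))
              (mul_nonneg (hν0 _) (hν0 _))
        _ = _ := by ring
    calc ν s * chainMix ent ent' 1 c d' s * x s * (ν t * chainMix ent ent' 1 c d' t * y t)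
        = (ν s * chainMix ent ent' 1 c d' s * (ν t * chainMix ent ent' 1 c d' t)) * (x s * y t) := by
          ring
      _ ≤ (ν (s ∩ t) * chainMix ent ent' 1 c d' (s ∩ t) * (ν (s ∪ t) * chainMix ent ent' 1 c d' (s ∪ t))) *
            (x (s ∪ t) * y (s ∪ t)) :=
          mul_le_mul hlsm (mul_le_mul hxs hyt (hy0 t) (hx0 _)) (mul_nonneg (hx0 s) (hy0 t))
            (mul_nonneg (mul_nonneg (hν0 _) (hm1' _)) (mul_nonneg (hν0 _) (hm1' _)))
      _ = _ := by ring
  have ha0 : 0 ≤ ∑ W ∈ U.powerset, ν W * chainMix ent ent' 0 c d W :=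
    Finset.sum_nonneg fun W _ => hR0_0 W
  -- the gate mass dominates the ideal mass
  have hgm : (∑ W ∈ U.powerset.filter (fun W => ¬ ∃ r ∈ ent ∪ ent', r ∈ W), ν W * c W) ≤
      ∑ W ∈ U.powerset, ν W * chainMix ent ent' 1 c d' W := by
    have e : (∑ W ∈ U.powerset.filter (fun W => ¬ ∃ r ∈ ent ∪ ent', r ∈ W), ν W * c W) =
        ∑ W ∈ U.powerset.filter (fun W => ¬ ∃ r ∈ ent ∪ ent', r ∈ W),
          ν W * chainMix ent ent' 1 c d' W :=
      Finset.sum_congr rfl fun W hW => by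
        rw [chainMix_of_not_meet ent ent' 1 c d' (Finset.mem_filter.1 hW).2]
    rw [e]
    exact Finset.sum_le_sum_of_subset_of_nonneg (Finset.filter_subset _ _) fun W _ _ => hG1_0 W
  have hg0 : 0 < ∑ W ∈ U.powerset, ν W * chainMix ent ent' 1 c d' W := lt_of_lt_of_le hmI hgm
  -- the FKG bound in the cleared form `K̃_x K̃_y ≤ g0 · U001`
  have hfkg : (((∑ W ∈ U.powerset, ν W * chainMix ent ent' 0 c d W * x W) * (∑ W ∈ U.powerset, ν W * chainMix ent ent' 1 c d' W) - (∑ W ∈ U.powerset, ν W * chainMix ent ent' 0 c d W) * (∑ W ∈ U.powerset, ν W * chainMix ent ent' 1 c d' W * x W)) * ((∑ W ∈ U.powerset, ν W * chainMix ent ent' 0 c d W * y W) * (∑ W ∈ U.powerset, ν W * chainMix ent ent' 1 c d' W) - (∑ W ∈ U.powerset, ν W * chainMix ent ent' 0 c d W) * (∑ W ∈ U.powerset, ν W * chainMix ent ent' 1 c d' W * y W))) ≤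
      (∑ W ∈ U.powerset, ν W * chainMix ent ent' 1 c d' W) *
      ((∑ W ∈ U.powerset, ν W * chainMix ent ent' 0 c d W) * (∑ W ∈ U.powerset, ν W * chainMix ent ent' 0 c d W) * (∑ W ∈ U.powerset, ν W * chainMix ent ent' 1 c d' W * (x W * y W))
        - (∑ W ∈ U.powerset, ν W * chainMix ent ent' 0 c d W) * (∑ W ∈ U.powerset, ν W * chainMix ent ent' 0 c d W * y W) * (∑ W ∈ U.powerset, ν W * chainMix ent ent' 1 c d' W * x W)
        - (∑ W ∈ U.powerset, ν W * chainMix ent ent' 0 c d W) * (∑ W ∈ U.powerset, ν W * chainMix ent ent' 0 c d W * x W) * (∑ W ∈ U.powerset, ν W * chainMix ent ent' 1 c d' W * y W)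
        + (∑ W ∈ U.powerset, ν W * chainMix ent ent' 0 c d W * x W) * (∑ W ∈ U.powerset, ν W * chainMix ent ent' 0 c d W * y W) * (∑ W ∈ U.powerset, ν W * chainMix ent ent' 1 c d' W)) := by
    nlinarith [mul_nonneg (mul_nonneg ha0 ha0) (sub_nonneg.2 hfkg0)]
  exact xa_crude_alg _ _ _ _ _ hg0 ha0 hfkg hF

end XACrude

end Summit.Ventures.PercRepro2.Coin
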